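import Mathlib
import HarnessLib
import Summits.KontsevichZagierPeriods.KontsevichZagierPeriods.Theses.LinRedNormalForm
import Summits.KontsevichZagierPeriods.KontsevichZagierPeriods.Theorems.LinRedNormalFormDihedralNormalFormStubNestedReductionAux1
import Literature.NumberTheory.Transcendental.BoxIntegralZetaValues
import Summits.KontsevichZagierPeriods.KontsevichZagierPeriods.Theorems.FurushoPentagonHoffmanRelationInKZDescents

/-!
# `DihedralNormalForm`, line `torus-descent-sum-shadow`, stub `stub_nestedReduction` — Aux 2

Support file for the stub `stub_nestedReduction` (THEOREM N) of the crux `DihedralNormalForm`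
(stmt-KontsevichZagierPeriods-3912, route `LinRedNormalForm`).

* **Rule 3 along the last coordinate of the OPEN cube** (`Nested.nl_last_ocube`, registered as
  the tool sub-goal `stub_nestedReductionAux2`): the Newton–Leibniz move of `KZCalculus` lives
  on the CLOSED band `{(x,t) | x ∈ τ, 0 ≤ t ≤ 1}`; cubical atoms live on the open cube; the two
  differ by the null faces `t = 0`, `t = 1`, so the bookkeeping of
  `FurushoPentagon.HoffmanRelationInKZ.descents_closeBand` applies.  This is the packaging of
  every axis Newton–Leibniz step of Theorem N (for an axis other than the last one it is
  conjugated by a coordinate permutation).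
* The `k = 2` family `g2 c A B n = c · x₀^{A₀} x₁^{A₁} (1−x₀)^{B₀} (1−x₁)^{B₁} / (1−x₀x₁)ⁿ`:
  domination by the `ζ(2)` kernel for `n ≤ B₀ + B₁ + 1` (sufficiency of the convergence
  criterion in dimension `2`), the representations `rep2`, `polyRep1`, and the two terminal
  shapes: the kernel with distinct exponents is SD1-directed, the bare kernel is the `ζ(2)` word
  atom.

References: M. Kontsevich, D. Zagier, *Periods* (2001), §1.2, rules (1)–(3).
-/

noncomputable section

open MeasureTheory Set

namespace Summit.KontsevichZagierPeriods.DihedralNormalForm.TorusDescent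

open Literature.NumberTheory.Transcendental

namespace Nested

/-! ## Rule 3 along the last coordinate of the open cube -/

/-- The closed band over the open cube, `{z | init z ∈ (0,1)ᵏ ∧ 0 ≤ z_last ≤ 1}`. -/
def cband (k : ℕ) : Set (Fin (k + 1) → ℝ) := KZlog.band (ocube k) (fun _ => 0) (fun _ => 1)

/-- Unfolding `cband`. -/
theorem cband_eq (k : ℕ) : cband k = KZlog.band (ocube k) (fun _ => 0) (fun _ => 1) := rfl

/-- Membership in the closed band. -/
theorem mem_cband {k : ℕ} {z : Fin (k + 1) → ℝ} :
    z ∈ cband k ↔ (∀ i : Fin k, z (Fin.castSucc i) ∈ Ioo (0:ℝ) 1) ∧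
      0 ≤ z (Fin.last k) ∧ z (Fin.last k) ≤ 1 := by
  simp only [cband, KZlog.mem_band, ocube, mem_setOf_eq]
  rfl

/-- The closed band as the set written in the registered tool statement. -/
theorem cband_eq_setOf (k : ℕ) : cband k = {z : Fin (k + 1) → ℝ |
    (∀ i : Fin k, z (Fin.castSucc i) ∈ Set.Ioo (0:ℝ) 1) ∧ z (Fin.last k) ∈ Set.Icc (0:ℝ) 1} := by
  ext z
  rw [mem_cband]
  rfl

/-- Constants are semialgebraic functions on the open cube. -/
theorem isSemialgebraicFunOn_const_ocube (k : ℕ) (c : ℚ) :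
    IsSemialgebraicFunOn ℚ (ocube k) (fun _ : Fin k → ℝ => (c : ℝ)) := by
  simpa using isSemialgebraicFunOn_aeval (R := ℝ) (isSemialgebraic_ocube k)
    (MvPolynomial.C c : MvPolynomial (Fin k) ℚ)

/-- The closed band is `ℚ`-semialgebraic. -/
theorem isSemialgebraic_cband (k : ℕ) :
    Literature.ModelTheory.ExponentialFields.IsSemialgebraic ℚ (cband k) := by
  have h0 := isSemialgebraicFunOn_const_ocube k 0
  have h1 := isSemialgebraicFunOn_const_ocube k 1
  simp only [Rat.cast_zero, Rat.cast_one] at h0 h1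
  exact KZlog.isSemialgebraic_band h0 h1

/-- The open cube of one dimension more lies in the closed band. -/
theorem ocube_succ_subset_cband (k : ℕ) : ocube (k + 1) ⊆ cband k := fun _ hz =>
  mem_cband.mpr ⟨fun i => hz (Fin.castSucc i), (hz (Fin.last k)).1.le, (hz (Fin.last k)).2.le⟩

/-- The closed band minus the open cube lies in the two faces `z_last = 0`, `z_last = 1`. -/
theorem cband_diff_subset (k : ℕ) :
    cband k \ ocube (k + 1) ⊆ {z | z (Fin.last k) = 0} ∪ {z | z (Fin.last k) = 1} := by
  rintro z ⟨hz, hnot⟩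
  obtain ⟨hinit, h0, h1⟩ := mem_cband.mp hz
  by_contra hcon
  simp only [mem_union, mem_setOf_eq, not_or] at hcon
  refine hnot fun i => ?_
  rcases Fin.eq_castSucc_or_eq_last i with ⟨j, rfl⟩ | rfl
  · exact hinit j
  · exact ⟨lt_of_le_of_ne h0 (Ne.symm hcon.1), lt_of_le_of_ne h1 hcon.2⟩

/-- The collar `cband ∖ ocube` is Lebesgue-null (two coordinate hyperplanes). -/
theorem volume_cband_diff (k : ℕ) : volume (cband k \ ocube (k + 1)) = 0 := by
  refine measure_mono_null (cband_diff_subset k) (measure_union_null ?_ ?_) <;>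
    exact Measure.pi_hyperplane (μ := fun _ : Fin (k + 1) => (volume : Measure ℝ)) (Fin.last k) _

/-- **Rule 3 along the last coordinate of the open cube.**  If `R = [(0,1)ᵏ⁺¹, W]` and
`rb = [(0,1)ᵏ, F(·,1) − F(·,0)]` are representations, `F`, `W` are `ℚ`-semialgebraic on the closed
band, and on every fibre over the open cube `t ↦ F(x,t)` is continuous on `[0,1]` with derivative
`W(x,t)` on `(0,1)`, then `[R] − [rb] ∈ KZ.relations` (close the band by the two null faces, one
Newton–Leibniz move with edges `a = 0 ≤ b = 1`). -/
theorem nl_last_ocube {k : ℕ} (R : KZ.IntegralRep (k + 1)) (rb : KZ.IntegralRep k)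
    (F W : (Fin (k + 1) → ℝ) → ℝ) (hRdom : R.domain = ocube (k + 1))
    (hRW : EqOn R.integrand W R.domain) (hbdom : rb.domain = ocube k)
    (hW : IsSemialgebraicFunOn ℚ (cband k) W) (hF : IsSemialgebraicFunOn ℚ (cband k) F)
    (hcont : ∀ x ∈ ocube k, ContinuousOn (fun t : ℝ => F (Fin.snoc x t)) (Icc 0 1))
    (hder : ∀ x ∈ ocube k, ∀ t ∈ Ioo (0 : ℝ) 1,
      HasDerivAt (fun s : ℝ => F (Fin.snoc x s)) (W (Fin.snoc x t)) t)
    (hbase : ∀ x ∈ ocube k, rb.integrand x = F (Fin.snoc x 1) - F (Fin.snoc x 0)) :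
    KZ.of R - KZ.of rb ∈ KZ.relations := by
  have h0 : IsSemialgebraicFunOn ℚ rb.domain (fun _ : Fin k → ℝ => (0 : ℝ)) := by
    simpa [hbdom] using isSemialgebraicFunOn_const_ocube k 0
  have h1 : IsSemialgebraicFunOn ℚ rb.domain (fun _ : Fin k → ℝ => (1 : ℝ)) := by
    simpa [hbdom] using isSemialgebraicFunOn_const_ocube k 1
  have hband : KZlog.band rb.domain (fun _ => 0) (fun _ => 1) = cband k := by rw [hbdom]; rfl
  refine FurushoPentagon.HoffmanRelationInKZ.descents_closeBand R rb (fun _ => 0) (fun _ => 1) W F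
    h0 h1 (fun _ _ => zero_le_one) (by rw [hband]; exact hW) (by rw [hband]; exact hF)
    (fun x hx => hcont x (by simpa [hbdom] using hx))
    (fun x hx => hder x (by simpa [hbdom] using hx))
    (fun x hx => hbase x (by simpa [hbdom] using hx)) ?_ hRW ?_
  · rw [hband, hRdom]; exact ocube_succ_subset_cband k
  · rw [hband, hRdom]; exact volume_cband_diff k

/-! ## `k = 2`: the family `g2 c A B n = c · x₀^{A₀} x₁^{A₁} (1−x₀)^{B₀} (1−x₁)^{B₁} / (1−x₀x₁)ⁿ` -/

/-- On dimension `2` the atom integrand is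
`q · x₀^{a 0} x₁^{a 1} · (1−x₀)^{e 0 0} (1−x₀x₁)^{e 0 1} (1−x₁)^{e 1 1}`. -/
theorem atomQ_two (q : ℚ) (a : Fin 2 → ℕ) (e : Fin 2 → Fin 2 → ℤ) (x : Fin 2 → ℝ) :
    atomQ 2 q a e x = (q : ℝ) * (x 0 ^ a 0 * x 1 ^ a 1 *
      ((1 - x 0) ^ e 0 0 * (1 - x 0 * x 1) ^ e 0 1 * (1 - x 1) ^ e 1 1)) := by
  simp [atomQ, Fin.prod_univ_two]

/-- The `k = 2` integrand family with natural exponents and denominator power `n`. -/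
def g2 (c : ℚ) (A0 A1 B0 B1 n : ℕ) (x : Fin 2 → ℝ) : ℝ :=
  (c : ℝ) * (x 0 ^ A0 * x 1 ^ A1 * (1 - x 0) ^ B0 * (1 - x 1) ^ B1 / (1 - x 0 * x 1) ^ n)

/-- Basic inequalities on the open square. -/
theorem two_facts {x : Fin 2 → ℝ} (hx : x ∈ ocube 2) :
    0 < x 0 ∧ x 0 < 1 ∧ 0 < x 1 ∧ x 1 < 1 ∧ 0 < 1 - x 0 * x 1 ∧ 1 - x 0 * x 1 ≤ 1 ∧
      1 - x 0 ≤ 1 - x 0 * x 1 ∧ 1 - x 1 ≤ 1 - x 0 * x 1 := by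
  have h0 := hx 0
  have h1 := hx 1
  simp only [mem_Ioo] at h0 h1
  have hp : 0 < x 0 * x 1 := mul_pos h0.1 h1.1
  have hlt : x 0 * x 1 < 1 := by nlinarith
  refine ⟨h0.1, h0.2, h1.1, h1.2, by linarith, by linarith, by nlinarith, by nlinarith⟩

/-- **Domination** (sufficiency of the convergence criterion at `k = 2`): for `n ≤ B₀ + B₁ + 1`,
`|g2| ≤ |c| / (1 − x₀x₁)` on the open square. -/
theorem abs_g2_le {c : ℚ} {A0 A1 B0 B1 n : ℕ} (h : n ≤ B0 + B1 + 1) {x : Fin 2 → ℝ}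
    (hx : x ∈ ocube 2) : |g2 c A0 A1 B0 B1 n x| ≤ |(c : ℝ)| * (1 / (1 - x 0 * x 1)) := by
  obtain ⟨h0, h0', h1, h1', hu, hu1, hle0, hle1⟩ := two_facts hx
  have hnum : x 0 ^ A0 * x 1 ^ A1 * (1 - x 0) ^ B0 * (1 - x 1) ^ B1 ≤
      (1 - x 0 * x 1) ^ (B0 + B1) := by
    have e1 : x 0 ^ A0 ≤ 1 := pow_le_one₀ h0.le h0'.le
    have e2 : x 1 ^ A1 ≤ 1 := pow_le_one₀ h1.le h1'.le
    have e3 : (1 - x 0) ^ B0 ≤ (1 - x 0 * x 1) ^ B0 := pow_le_pow_left₀ (by linarith) hle0 B0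
    have e4 : (1 - x 1) ^ B1 ≤ (1 - x 0 * x 1) ^ B1 := pow_le_pow_left₀ (by linarith) hle1 B1
    calc x 0 ^ A0 * x 1 ^ A1 * (1 - x 0) ^ B0 * (1 - x 1) ^ B1
        ≤ 1 * 1 * (1 - x 0 * x 1) ^ B0 * (1 - x 0 * x 1) ^ B1 :=
          mul_le_mul (mul_le_mul (mul_le_mul e1 e2 (by positivity) zero_le_one) e3
            (pow_nonneg (by linarith) _) (by positivity)) e4 (pow_nonneg (by linarith) _)
            (by positivity)
      _ = (1 - x 0 * x 1) ^ (B0 + B1) := by rw [one_mul, one_mul, pow_add]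
  have hpow : (1 - x 0 * x 1) ^ (B0 + B1 + 1) ≤ (1 - x 0 * x 1) ^ n :=
    pow_le_pow_of_le_one hu.le hu1 h
  have hnn : 0 ≤ x 0 ^ A0 * x 1 ^ A1 * (1 - x 0) ^ B0 * (1 - x 1) ^ B1 :=
    mul_nonneg (mul_nonneg (by positivity) (pow_nonneg (by linarith) _)) (pow_nonneg (by linarith) _)
  rw [g2, abs_mul, abs_of_nonneg (div_nonneg hnn (pow_nonneg hu.le _))]
  refine mul_le_mul_of_nonneg_left ?_ (abs_nonneg _)
  rw [div_le_div_iff₀ (pow_pos hu _) hu, one_mul]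
  calc x 0 ^ A0 * x 1 ^ A1 * (1 - x 0) ^ B0 * (1 - x 1) ^ B1 * (1 - x 0 * x 1)
      ≤ (1 - x 0 * x 1) ^ (B0 + B1) * (1 - x 0 * x 1) := mul_le_mul_of_nonneg_right hnum hu.le
    _ = (1 - x 0 * x 1) ^ (B0 + B1 + 1) := by rw [pow_succ]
    _ ≤ (1 - x 0 * x 1) ^ n := hpow

/-- The family `g2` is measurable. -/
theorem measurable_g2 (c : ℚ) (A0 A1 B0 B1 n : ℕ) : Measurable (g2 c A0 A1 B0 B1 n) := by
  unfold g2; fun_prop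

/-- **Absolute convergence** of `g2` for `n ≤ B₀ + B₁ + 1` (dominated by the `ζ(2)` kernel,
`box_integral_one_div_one_sub_mul_two`). -/
theorem integrableOn_g2 (c : ℚ) (A0 A1 B0 B1 n : ℕ) (h : n ≤ B0 + B1 + 1) :
    IntegrableOn (g2 c A0 A1 B0 B1 n) (ocube 2) := by
  have hz := (box_integral_one_div_one_sub_mul_two.1).const_mul |(c : ℝ)|
  refine Integrable.mono' hz (measurable_g2 c A0 A1 B0 B1 n).aestronglyMeasurable ?_
  exact ae_restrict_of_forall_mem (measurableSet_ocube 2) fun x hx => by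
    rw [Real.norm_eq_abs]; exact abs_g2_le h hx

/-- `g2` as a quotient of polynomials with rational coefficients. -/
theorem g2_eq_aeval_div (c : ℚ) (A0 A1 B0 B1 n : ℕ) (x : Fin 2 → ℝ) :
    g2 c A0 A1 B0 B1 n x =
      MvPolynomial.aeval x (MvPolynomial.C c * MvPolynomial.X 0 ^ A0 * MvPolynomial.X 1 ^ A1 *
        (1 - MvPolynomial.X 0) ^ B0 * (1 - MvPolynomial.X 1) ^ B1 : MvPolynomial (Fin 2) ℚ) /
      MvPolynomial.aeval x ((1 - MvPolynomial.X 0 * MvPolynomial.X 1) ^ n : MvPolynomial (Fin 2) ℚ) := by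
  simp only [g2, map_mul, map_pow, map_sub, map_one, MvPolynomial.aeval_X, MvPolynomial.aeval_C]
  simp [mul_div_assoc, mul_assoc]

/-- `g2` is `ℚ`-semialgebraic on any `ℚ`-semialgebraic set where `x₀x₁ ≠ 1`. -/
theorem isSemialgebraicFunOn_g2 {S : Set (Fin 2 → ℝ)}
    (hS : Literature.ModelTheory.ExponentialFields.IsSemialgebraic ℚ S)
    (hS1 : ∀ x ∈ S, 1 - x 0 * x 1 ≠ 0) (c : ℚ) (A0 A1 B0 B1 n : ℕ) :
    IsSemialgebraicFunOn ℚ S (g2 c A0 A1 B0 B1 n) := by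
  refine (isSemialgebraicFunOn_aeval_div_aeval hS _ _ fun x hx => ?_).congr
    fun x _ => (g2_eq_aeval_div c A0 A1 B0 B1 n x).symm
  simpa using pow_ne_zero n (hS1 x hx)

/-- **The `k = 2` representations** `[□², g2 c A B n]` for `n ≤ B₀ + B₁ + 1`. -/
def rep2 (c : ℚ) (A0 A1 B0 B1 n : ℕ) (h : n ≤ B0 + B1 + 1) : KZ.IntegralRep 2 where
  domain := ocube 2
  integrand := g2 c A0 A1 B0 B1 n
  isSemialgebraic_domain := isSemialgebraic_ocube 2
  isSemialgebraicFunOn_integrand :=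
    isSemialgebraicFunOn_g2 (isSemialgebraic_ocube 2) (fun _ hx => (two_facts hx).2.2.2.2.1.ne') _ _ _ _ _ _
  integrableOn := integrableOn_g2 c A0 A1 B0 B1 n h

/-- The domain of `rep2`. -/
@[simp] theorem rep2_domain (c : ℚ) (A0 A1 B0 B1 n : ℕ) (h : n ≤ B0 + B1 + 1) :
    (rep2 c A0 A1 B0 B1 n h).domain = ocube 2 := rfl

/-- The integrand of `rep2`. -/
@[simp] theorem rep2_integrand (c : ℚ) (A0 A1 B0 B1 n : ℕ) (h : n ≤ B0 + B1 + 1) :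
    (rep2 c A0 A1 B0 B1 n h).integrand = g2 c A0 A1 B0 B1 n := rfl

/-- **Polynomial representations of dimension `1`**: `[□¹, c x₀ᴬ (1 − x₀)ᴮ]`. -/
def polyRep1 (c : ℚ) (A B : ℕ) : KZ.IntegralRep 1 where
  domain := ocube 1
  integrand := fun x => (c : ℝ) * (x 0 ^ A * (1 - x 0) ^ B)
  isSemialgebraic_domain := isSemialgebraic_ocube 1
  isSemialgebraicFunOn_integrand := by
    refine (isSemialgebraicFunOn_aeval (isSemialgebraic_ocube 1)
      (MvPolynomial.C c * MvPolynomial.X 0 ^ A * (1 - MvPolynomial.X 0) ^ B)).congr fun x _ => ?_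
    simp [mul_assoc]
  integrableOn := by
    refine integrableOn_ocube_of_bound (by fun_prop) |(c : ℝ)| fun x hx => ?_
    have h0 := hx 0
    rw [abs_mul]
    refine mul_le_of_le_one_right (abs_nonneg _) ?_
    rw [abs_mul, abs_pow, abs_pow, abs_of_pos h0.1, abs_of_pos (by linarith [h0.2])]
    exact mul_le_one₀ (pow_le_one₀ h0.1.le h0.2.le) (pow_nonneg (by linarith [h0.2]) _)
      (pow_le_one₀ (by linarith [h0.2]) (by linarith [h0.1]))

/-- A polynomial representation of dimension `1` is an atom of dimension `1 < 2`, hence in the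
target of dimension `2`. -/
theorem of_polyRep1_mem_target (c : ℚ) (A B : ℕ) : KZ.of (polyRep1 c A B) ∈ Target 2 := by
  refine of_mem_target_of_lt Nat.one_lt_two c (fun _ => A) (fun _ _ => (B : ℤ)) (polyRep1 c A B) rfl
    fun x _ => ?_
  rw [atomQ_one, zpow_natCast]
  rfl

/-- **The kernel with distinct exponents is SD1-directed**: `[□², c x₀ᵖ x₁^q/(1−x₀x₁)]`, `p ≠ q`,
has the descent direction `lam = (1, −1)` (one `+1`, `E = p − q ≠ 0`). -/
theorem of_rep2_kernel_mem_target_of_ne (c : ℚ) {p q : ℕ} (hpq : p ≠ q) :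
    KZ.of (rep2 c p q 0 0 1 (by omega)) ∈ Target 2 := by
  refine of_mem_target_of_sd1 c ![p, q] (fun i j => if i = 0 ∧ j = 1 then -1 else 0)
    (rep2 c p q 0 0 1 (by omega)) ![1, -1] (fun l => ?_) ⟨1, rfl⟩ (by decide)
    (fun i j hij hne => ?_) ?_ rfl fun x hx => ?_
  · fin_cases l <;> simp
  · fin_cases i <;> fin_cases j <;> simp_all [Fin.sum_univ_two]
  · simp [Fin.sum_univ_two]
    omega
  · rw [rep2_integrand, atomQ_two]
    simp [g2, div_eq_mul_inv]

/-- **The bare kernel is the `ζ(2)` word atom**: `[□², c/(1−x₀x₁)]` is the word atom of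
`ε = (0, 1)` (`c · x₀ · (1/x₀) · 1/(1−x₀x₁)` on the open square). -/
theorem rep2_word_eqOn (c : ℚ) :
    EqOn (rep2 c 0 0 0 0 1 (by omega)).integrand (fun x : Fin 2 → ℝ => (c : ℝ) *
      ((∏ i : Fin 2, x i ^ (2 - 1 - (i : ℕ))) *
        ∏ i : Fin 2, if (![false, true] : Fin 2 → Bool) i then
          1 / (1 - (∏ l : Fin 2, if l ≤ i then x l else 1))
          else 1 / (∏ l : Fin 2, if l ≤ i then x l else 1)))
      (rep2 c 0 0 0 0 1 (by omega)).domain := by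
  intro x hx
  have h0 := (two_facts hx).1
  have h10 : ¬ ((1 : Fin 2) ≤ 0) := by decide
  have h01 : ((0 : Fin 2) ≤ 1) := by decide
  simp only [rep2_integrand, g2, Fin.prod_univ_two, Matrix.cons_val_zero, Matrix.cons_val_one,
    le_refl, if_true, h10, h01, if_false, Bool.false_eq_true, pow_zero, pow_one, mul_one,
    Fin.val_zero, Fin.val_one, Nat.sub_self, show 2 - 1 = 1 from rfl]
  field_simp

/-- The bare kernel lies in the target (it is the `ζ(2)` word atom, `ε = (0,1)`). -/
theorem of_rep2_word_mem_target (c : ℚ) : KZ.of (rep2 c 0 0 0 0 1 (by omega)) ∈ Target 2 :=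
  of_mem_target_of_word c ![false, true] _ rfl (rep2_word_eqOn c)

end Nested

/-- **Registered tool sub-goal `stub_nestedReductionAux2`**: rule 3 (Newton–Leibniz) along the
last coordinate of the OPEN cube, with the closed band written out (`Nested.nl_last_ocube`). -/
theorem stub_nestedReductionAux2 : ∀ (k : ℕ) (R : Literature.NumberTheory.Transcendental.KZ.IntegralRep (k + 1)) (rb : Literature.NumberTheory.Transcendental.KZ.IntegralRep k) (F W : (Fin (k + 1) → ℝ) → ℝ), R.domain = {x : Fin (k + 1) → ℝ | ∀ i, x i ∈ Set.Ioo (0:ℝ) 1} → Set.EqOn R.integrand W R.domain → rb.domain = {x : Fin k → ℝ | ∀ i, x i ∈ Set.Ioo (0:ℝ) 1} → Literature.NumberTheory.Transcendental.IsSemialgebraicFunOn ℚ {z : Fin (k + 1) → ℝ | (∀ i : Fin k, z (Fin.castSucc i) ∈ Set.Ioo (0:ℝ) 1) ∧ z (Fin.last k) ∈ Set.Icc (0:ℝ) 1} W → Literature.NumberTheory.Transcendental.IsSemialgebraicFunOn ℚ {z : Fin (k + 1) → ℝ | (∀ i : Fin k, z (Fin.castSucc i) ∈ Set.Ioo (0:ℝ)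 1) ∧ z (Fin.last k) ∈ Set.Icc (0:ℝ) 1} F → (∀ x ∈ {x : Fin k → ℝ | ∀ i, x i ∈ Set.Ioo (0:ℝ) 1}, ContinuousOn (fun t : ℝ => F (Fin.snoc x t)) (Set.Icc 0 1)) → (∀ x ∈ {x : Fin k → ℝ | ∀ i, x i ∈ Set.Ioo (0:ℝ) 1}, ∀ t ∈ Set.Ioo (0:ℝ) 1, HasDerivAt (fun s : ℝ => F (Fin.snoc x s)) (W (Fin.snoc x t)) t) → (∀ x ∈ {x : Fin k → ℝ | ∀ i, x i ∈ Set.Ioo (0:ℝ) 1}, rb.integrand x = F (Fin.snoc x 1) - F (Fin.snoc x 0)) → Literature.NumberTheory.Transcendental.KZ.of R - Literature.NumberTheory.Transcendental.KZ.of rb ∈ Literature.NumberTheory.Transcendental.KZ.relations := by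
  intro k R rb F W hRdom hRW hbdom hW hF hcont hder hbase
  rw [← Nested.cband_eq_setOf] at hW hF
  exact Nested.nl_last_ocube R rb F W hRdom hRW hbdom hW hF hcont hder hbase

end Summit.KontsevichZagierPeriods.DihedralNormalForm.TorusDescent
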